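import Mathlib
import HarnessLib
import Literature.MathematicalPhysics.KineticTheory.FluctuationAbelPositivity
import Literature.MathematicalPhysics.KineticTheory.FluctuationUnitaryGroup
import Literature.MathematicalPhysics.KineticTheory.ZeroWavenumberSpace
import Summits.AtomisticToContinuum.FouriersLaw.Theorems.JunctionLocalityConductanceLowerBoundAbelFloorFrequently

/-!
# Exact coboundaries are Abel insulators: the kill condition of line `abel-floor-exchange`, typed
# (crux `ConductanceLowerBound`, item stmt-AtomisticToContinuum-11749; `--supports`, closes nothing; lead c7)

Skeleton v3 of the line reduces the crux to the sibling (R) (stmt-13416) and the bulk stub (A⁻⁻), kernel-certified EQUIVALENT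
(p161612) to W⁻ = "the shift-invariant Gibbs bulk is NOT AN ABEL INSULATOR" (`limsup_{ν↓0} Â(ν) > 0`,
`Â(ν) = ∫₀^∞ e^{−νt} C_T(t) dt`).  The only mechanism ever proposed for an Abel-insulating translation-invariant anharmonic bulk is
De Roeck–Huveneers' asymptotic localisation: the total current is a COBOUNDARY of the infinite Liouvillian to every order of
perturbation theory.  This file proves that an EXACT coboundary is exactly what kills the line — and, given the sibling (R), the
crux and hence Fourier's law:

* §1 (abstract, any strongly continuous one-parameter unitary group `U(t) = e^{tA}` on a complex Hilbert space):
  `∫₀^∞ e^{−νt} Re⟪Aφ, U(t)Aφ⟫ dt = ν‖φ‖² − ν³‖R(ν)φ‖² ≤ ν‖φ‖²` for `φ ∈ D(A)` (`R(ν) = ∫₀^∞e^{−νt}U(t)dt`; Engel–Nagel II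
  Thm 1.10: `R(ν)Aφ = νR(ν)φ − φ`, `Re⟪φ,R(ν)φ⟫ = ν‖R(ν)φ‖²`), so the Abel functional of an exact coboundary `ψ = Aφ` is `O(ν)`.
* §2 (any strongly continuous `FluctuationDynamics`, real Koopman group `U_t` with skew generator `L`): for `φ ∈ D(L)`,
  `∫₀^∞ e^{−νt} ⟪Lφ, U_t Lφ⟫ dt ≤ ν‖φ‖²` (complexification).
* §3 (the chain on Doyon's `ℋ₀(μ)`): if the current class is an exact coboundary, `[J] = Lφ`, then
  `∫₀^∞ e^{−νt} C_μ(t) dt ≤ ν‖φ‖²` and the Abel functional tends to `0` as `ν ↓ 0`: the bulk IS an Abel insulator.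
* §4 (the crux): `CurrentCoboundary` — for all parameters `> 0` and `T > 0` some regular shift-invariant Gibbs witness carries
  zero-wavenumber data with strongly continuous Koopman group in which `[J]` is an exact coboundary — implies `¬(A⁻⁻)`
  (`abelFloorFrequently_openChain_false_of_currentCoboundary`, via the landed matching S3 at that witness), hence `¬W⁻`, `¬W`,
  `¬(A⁻)`, and together with (R) `¬ConductanceLowerBound` (`conductanceLowerBound_false_of_currentCoboundary_of_uniformAbelianRegularity`).

So a disprover of stmt-11749 (given stmt-13416) must produce an `ℋ₀`-PRIMITIVE of the current; conversely every proof of the bulk stub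
must show that no such primitive exists (the current is not an exact time-derivative in `ℋ₀`) — and more (not even an Abel-approximate one).
References: Engel–Nagel 2000 Ch. II Thm 1.10; Reed–Simon I Thm VIII.7; Doyon 2022 §4; De Roeck–Huveneers 2015 (asymptotic localisation).
No definitions (the hypothesis is spelled out), no named facts, no sorry.
-/

noncomputable section

open MeasureTheory Filter Set Topology
open scoped InnerProductSpace NNReal
open Literature.Analysis.UnboundedOperators

namespace Summit.AtomisticToContinuum.FouriersLaw.Cruxes.ConductanceLowerBound.AbelFloorExchange

namespace UnitaryAbel

variable {H : Type*} [NormedAddCommGroup H] [InnerProductSpace ℂ H] [CompleteSpace H]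

/-- **Abel functional of an exact coboundary — the identity.**  For a strongly continuous one-parameter unitary group `U` with
generator `A`, `φ ∈ D(A)` and `ν > 0`:
`∫₀^∞ e^{−νt} Re⟪Aφ, U(t)Aφ⟫ dt = ν‖φ‖² − ν³‖R(ν)φ‖²`, `R(ν)φ = ∫₀^∞ e^{−νt}U(t)φ dt`
(`R(ν)Aφ = νR(ν)φ − φ`, Engel–Nagel II Thm. 1.10 (iii); `Re⟪φ, R(ν)φ⟫ = ν‖R(ν)φ‖²`). [cite: EngelNagel2000, Ch. II Thm. 1.10] -/
theorem integral_exp_neg_mul_re_inner_appReal_generator_eq (U : OneParameterUnitaryGroup H) {ν : ℝ} (hν : 0 < ν)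
    (φ : (OneParameterGroup.generator U.toStrongContRepresentation).domain) :
    ∫ t in Ioi (0 : ℝ), Real.exp (-(ν * t)) *
        (⟪(OneParameterGroup.generator U.toStrongContRepresentation φ : H),
          U.appReal t (OneParameterGroup.generator U.toStrongContRepresentation φ : H)⟫_ℂ).re =
      ν * ‖(φ : H)‖ ^ 2 - ν ^ 3 * ‖∫ t in Ioi (0 : ℝ), Complex.exp (-((ν : ℂ) * t)) • U.appReal t (φ : H)‖ ^ 2 := by
  set T := OneParameterGroup.toC0Semigroup U.toStrongContRepresentation with hT
  have hM := U.norm_toC0Semigroup_app_le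
  have hl : (0 : ℝ) < ((ν : ℂ)).re := by simpa using hν
  set ψ : H := (OneParameterGroup.generator U.toStrongContRepresentation φ : H) with hψ
  set R : H := T.laplaceResolventFun (ν : ℂ) (φ : H) with hR
  have hReq : R = ∫ t in Ioi (0 : ℝ), Complex.exp (-((ν : ℂ) * t)) • U.appReal t (φ : H) :=
    U.laplaceResolventFun_toC0Semigroup_eq (ν : ℂ) (φ : H)
  -- the Abel functional of `ψ` is `ν ‖R(ν)ψ‖²`
  have h1 := U.integral_exp_neg_mul_re_inner_appReal hν ψ
  rw [← U.laplaceResolventFun_toC0Semigroup_eq (ν : ℂ) ψ] at h1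
  -- `R(ν) ψ = ν R(ν) φ − φ`
  have h2 : T.laplaceResolventFun (ν : ℂ) ψ = (ν : ℂ) • R - (φ : H) :=
    C0Semigroup.laplaceResolventFun_generator T hM hl φ
  -- `Re ⟪φ, R⟫ = ν ‖R‖²`
  have hRdom : R ∈ (OneParameterGroup.generator U.toStrongContRepresentation).domain :=
    C0Semigroup.laplaceResolventFun_mem_generator_domain T hM hl (φ : H)
  have hgen : (OneParameterGroup.generator U.toStrongContRepresentation ⟨R, hRdom⟩ : H) =
      (ν : ℂ) • R - (φ : H) :=
    C0Semigroup.generator_laplaceResolventFun T hM hl (φ : H)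
  have hφ : (φ : H) = (ν : ℂ) • R - OneParameterGroup.generator U.toStrongContRepresentation ⟨R, hRdom⟩ := by
    rw [hgen]; abel
  have h3 : (⟪(φ : H), R⟫_ℂ).re = ν * ‖R‖ ^ 2 := by
    have hskew := U.re_inner_generator_self ⟨R, hRdom⟩
    simp only at hskew
    conv_lhs => rw [hφ]
    rw [inner_sub_left, inner_smul_left, Complex.conj_ofReal, Complex.sub_re, Complex.re_ofReal_mul,
      inner_self_eq_norm_sq_to_K, hskew, sub_zero]
    norm_cast
  -- expand `‖νR − φ‖²`
  have h4 : ‖(ν : ℂ) • R - (φ : H)‖ ^ 2 = ν ^ 2 * ‖R‖ ^ 2 - 2 * ν * (⟪(φ : H), R⟫_ℂ).re + ‖(φ : H)‖ ^ 2 := by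
    rw [@norm_sub_sq ℂ, norm_smul, Complex.norm_real, Real.norm_of_nonneg hν.le, inner_smul_left,
      Complex.conj_ofReal, RCLike.re_to_complex, Complex.re_ofReal_mul, ← inner_conj_symm, Complex.conj_re]
    ring
  rw [h1, h2, h4, h3, hReq]
  ring

/-- **Exact coboundaries are Abel insulators (abstract form).**  For `φ ∈ D(A)` and `ν > 0`,
`0 ≤ ∫₀^∞ e^{−νt} Re⟪Aφ, U(t)Aφ⟫ dt ≤ ν‖φ‖²`; in particular the Abel functional of `ψ = Aφ` tends to `0` as `ν ↓ 0`.
[cite: EngelNagel2000, Ch. II Thm. 1.10] -/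
theorem integral_exp_neg_mul_re_inner_appReal_generator_le (U : OneParameterUnitaryGroup H) {ν : ℝ} (hν : 0 < ν)
    (φ : (OneParameterGroup.generator U.toStrongContRepresentation).domain) :
    ∫ t in Ioi (0 : ℝ), Real.exp (-(ν * t)) *
        (⟪(OneParameterGroup.generator U.toStrongContRepresentation φ : H),
          U.appReal t (OneParameterGroup.generator U.toStrongContRepresentation φ : H)⟫_ℂ).re ≤
      ν * ‖(φ : H)‖ ^ 2 := by
  rw [integral_exp_neg_mul_re_inner_appReal_generator_eq U hν φ]
  have : 0 ≤ ν ^ 3 * ‖∫ t in Ioi (0 : ℝ), Complex.exp (-((ν : ℂ) * t)) • U.appReal t (φ : H)‖ ^ 2 := by positivity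
  linarith

/-- The Abel functional of an exact coboundary tends to `0` as `ν ↓ 0`. [cite: EngelNagel2000, Ch. II Thm. 1.10] -/
theorem tendsto_integral_exp_neg_mul_re_inner_appReal_generator (U : OneParameterUnitaryGroup H)
    (φ : (OneParameterGroup.generator U.toStrongContRepresentation).domain) :
    Tendsto (fun ν : ℝ => ∫ t in Ioi (0 : ℝ), Real.exp (-(ν * t)) *
        (⟪(OneParameterGroup.generator U.toStrongContRepresentation φ : H),
          U.appReal t (OneParameterGroup.generator U.toStrongContRepresentation φ : H)⟫_ℂ).re)
      (𝓝[>] 0) (𝓝 0) := by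
  have hup : Tendsto (fun ν : ℝ => ν * ‖(φ : H)‖ ^ 2) (𝓝[>] 0) (𝓝 0) := by
    have : Tendsto (fun ν : ℝ => ν * ‖(φ : H)‖ ^ 2) (𝓝 0) (𝓝 (0 * ‖(φ : H)‖ ^ 2)) :=
      tendsto_id.mul_const _
    rw [zero_mul] at this
    exact this.mono_left nhdsWithin_le_nhds
  refine tendsto_of_tendsto_of_tendsto_of_le_of_le' tendsto_const_nhds hup ?_ ?_
  · filter_upwards [self_mem_nhdsWithin] with ν (hν : 0 < ν)
    exact U.integral_exp_neg_mul_re_inner_appReal_nonneg hν _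
  · filter_upwards [self_mem_nhdsWithin] with ν (hν : 0 < ν)
    exact integral_exp_neg_mul_re_inner_appReal_generator_le U hν φ

end UnitaryAbel

/-! ## §2 Fluctuation dynamics: the Abel functional of `Lφ` is `O(ν)` -/

namespace FluctuationAbel

open Literature.MathematicalPhysics.KineticTheory

variable {G Ω : Type*} [AddCommGroup G] [MeasurableSpace G] [MeasurableSpace Ω]
  {ν₀ : Measure G} {T : ShiftAction G Ω} (D : FluctuationDynamics ν₀ T)
  [MeasurableNeg G] [ν₀.IsNegInvariant]

/-- **Coboundaries of the real Koopman group are Abel insulators.**  For a strongly continuous fluctuation dynamics with real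
Koopman group `U_t` and generator `L` (strong derivative at `0`), every `φ ∈ D(L)` has
`∫₀^∞ e^{−νt} ⟪Lφ, U_t Lφ⟫ dt ≤ ν ‖φ‖²` (`ν > 0`) — by complexification and §1. [cite: EngelNagel2000, Ch. II Thm. 1.10] -/
theorem integral_exp_neg_mul_inner_koopman_generator_le (h : D.IsStronglyContinuous) {ν : ℝ} (hν : 0 < ν)
    (φ : D.generatorDomain) :
    ∫ t in Ioi (0 : ℝ), Real.exp (-(ν * t)) * ⟪D.generator φ, D.koopman t (D.generator φ)⟫_ℝ ≤
      ν * ‖(φ : D.FluctuationSpace)‖ ^ 2 := by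
  set U := D.unitaryGroup h with hU
  -- the complex orbit of `φ + i0` is differentiable at `0` with derivative `Lφ + i0`
  have hd0 : HasDerivAt (fun t : ℝ => U.appReal t (Complexification.ofReal (φ : D.FluctuationSpace)))
      (Complexification.ofReal (D.generator φ)) 0 := by
    have h' := ((Complexification.ofReal (E := D.FluctuationSpace)).toContinuousLinearMap.hasFDerivAt).comp_hasDerivAt
      (0 : ℝ) (D.hasDerivAt_koopman φ)
    have h2 : (fun t : ℝ => U.appReal t (Complexification.ofReal (φ : D.FluctuationSpace))) =
        ((Complexification.ofReal (E := D.FluctuationSpace)).toContinuousLinearMap ∘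
          fun t : ℝ => D.koopman t (φ : D.FluctuationSpace)) := by
      funext t
      exact D.unitaryGroup_appReal_ofReal h t _
    rw [h2]
    exact h'
  have hd : HasDerivAt (fun t : ℝ => OneParameterGroup.app U.toStrongContRepresentation t
      (Complexification.ofReal (φ : D.FluctuationSpace))) (Complexification.ofReal (D.generator φ)) 0 := by
    simpa only [UnitaryRep.app_toStrongContRepresentation] using hd0
  obtain ⟨hx, hval⟩ := OneParameterGroup.mem_generator_domain_of_hasDerivAt U.toStrongContRepresentation hd
  -- §1 at the complex domain element `φ + i0`
  have key := UnitaryAbel.integral_exp_neg_mul_re_inner_appReal_generator_le U hν ⟨_, hx⟩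
  rw [hval] at key
  have hnorm : ‖(Complexification.ofReal (φ : D.FluctuationSpace))‖ = ‖(φ : D.FluctuationSpace)‖ :=
    (Complexification.ofReal (E := D.FluctuationSpace)).norm_map _
  simp only [hnorm] at key
  -- the real integrand is the real part of the complex one
  have hre : ∀ t : ℝ, Real.exp (-(ν * t)) * ⟪D.generator φ, D.koopman t (D.generator φ)⟫_ℝ =
      Real.exp (-(ν * t)) * (⟪Complexification.ofReal (D.generator φ),
        U.appReal t (Complexification.ofReal (D.generator φ))⟫_ℂ).re := fun t => by
    rw [D.inner_koopman_eq_re_inner_unitaryGroup h]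
  simp_rw [hre]
  exact key

/-- Hence the Abel functional of `Lφ` tends to `0` as `ν ↓ 0`. [cite: EngelNagel2000, Ch. II Thm. 1.10] -/
theorem tendsto_integral_exp_neg_mul_inner_koopman_generator (h : D.IsStronglyContinuous) (φ : D.generatorDomain) :
    Tendsto (fun ν : ℝ => ∫ t in Ioi (0 : ℝ), Real.exp (-(ν * t)) * ⟪D.generator φ, D.koopman t (D.generator φ)⟫_ℝ)
      (𝓝[>] 0) (𝓝 0) := by
  have hup : Tendsto (fun ν : ℝ => ν * ‖(φ : D.FluctuationSpace)‖ ^ 2) (𝓝[>] 0) (𝓝 0) := by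
    have : Tendsto (fun ν : ℝ => ν * ‖(φ : D.FluctuationSpace)‖ ^ 2) (𝓝 0) (𝓝 (0 * ‖(φ : D.FluctuationSpace)‖ ^ 2)) :=
      tendsto_id.mul_const _
    rw [zero_mul] at this
    exact this.mono_left nhdsWithin_le_nhds
  refine tendsto_of_tendsto_of_tendsto_of_le_of_le' tendsto_const_nhds hup ?_ ?_
  · filter_upwards [self_mem_nhdsWithin] with ν (hν : 0 < ν)
    exact h.integral_exp_neg_mul_inner_koopman_nonneg hν _
  · filter_upwards [self_mem_nhdsWithin] with ν (hν : 0 < ν)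
    exact integral_exp_neg_mul_inner_koopman_generator_le D h hν φ

end FluctuationAbel

/-! ## §3 The chain on `ℋ₀(μ)`: an exact coboundary current makes the bulk an Abel insulator -/

namespace ChainAbel

open Literature.MathematicalPhysics.KineticTheory
open Literature.MathematicalPhysics.KineticTheory.HeatConduction

variable {P : OscillatorChain} {Dyn : InfiniteChainDynamics P} (Z : ZeroWavenumberData P Dyn)

/-- **If `[J] = Lφ` in `ℋ₀(μ)` then `∫₀^∞ e^{−νt} C_μ(t) dt ≤ ν‖φ‖²`** (strongly continuous Koopman group, zero mean current).
[cite: EngelNagel2000, Ch. II Thm. 1.10] -/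
theorem abelFunctional_le_of_currentClass_eq_generator (hU : Z.toFluctuationDynamics.IsStronglyContinuous)
    (hmean : ∫ σ, P.bondCurrentZ σ 0 ∂Z.μ = 0) (φ : Z.toFluctuationDynamics.generatorDomain)
    (hφ : Z.toFluctuationDynamics.generator φ = Z.currentClass) {ν : ℝ} (hν : 0 < ν) :
    ∫ t in Ioi (0 : ℝ), Real.exp (-(ν * t)) * Dyn.currentCorrelation Z.μ t ≤
      ν * ‖(φ : Z.toFluctuationDynamics.FluctuationSpace)‖ ^ 2 := by
  have key := FluctuationAbel.integral_exp_neg_mul_inner_koopman_generator_le Z.toFluctuationDynamics hU hν φ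
  rw [hφ] at key
  simp_rw [← Z.inner_currentClass_koopman_eq_currentCorrelation hmean]
  exact key

/-- **… and the bulk is an Abel insulator**: `Â(ν) = ∫₀^∞ e^{−νt} C_μ(t) dt → 0` as `ν ↓ 0`. [cite: EngelNagel2000, Ch. II Thm. 1.10] -/
theorem tendsto_abelFunctional_zero_of_currentClass_eq_generator (hU : Z.toFluctuationDynamics.IsStronglyContinuous)
    (hmean : ∫ σ, P.bondCurrentZ σ 0 ∂Z.μ = 0) (φ : Z.toFluctuationDynamics.generatorDomain)
    (hφ : Z.toFluctuationDynamics.generator φ = Z.currentClass) :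
    Tendsto (fun ν : ℝ => ∫ t in Ioi (0 : ℝ), Real.exp (-(ν * t)) * Dyn.currentCorrelation Z.μ t) (𝓝[>] 0) (𝓝 0) := by
  have key := FluctuationAbel.tendsto_integral_exp_neg_mul_inner_koopman_generator Z.toFluctuationDynamics hU φ
  rw [hφ] at key
  simp_rw [← Z.inner_currentClass_koopman_eq_currentCorrelation hmean]
  exact key

/-- Quantitative form: for every `a > 0` there is `ν₁ > 0` with `Â(ν) < a` for all `ν ∈ (0, ν₁)` — no Abel floor, not even
frequently. [cite: EngelNagel2000, Ch. II Thm. 1.10] -/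
theorem abelFunctional_lt_of_currentClass_eq_generator (hU : Z.toFluctuationDynamics.IsStronglyContinuous)
    (hmean : ∫ σ, P.bondCurrentZ σ 0 ∂Z.μ = 0) (φ : Z.toFluctuationDynamics.generatorDomain)
    (hφ : Z.toFluctuationDynamics.generator φ = Z.currentClass) {a : ℝ} (ha : 0 < a) :
    ∃ ν₁ : ℝ, 0 < ν₁ ∧ ∀ ν : ℝ, 0 < ν → ν < ν₁ →
      ∫ t in Ioi (0 : ℝ), Real.exp (-(ν * t)) * Dyn.currentCorrelation Z.μ t < a := by
  refine ⟨a / (‖(φ : Z.toFluctuationDynamics.FluctuationSpace)‖ ^ 2 + 1), by positivity, fun ν hν hlt => ?_⟩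
  have h1 := abelFunctional_le_of_currentClass_eq_generator Z hU hmean φ hφ hν
  have hpos : 0 < ‖(φ : Z.toFluctuationDynamics.FluctuationSpace)‖ ^ 2 + 1 := by positivity
  have h2 : ν * (‖(φ : Z.toFluctuationDynamics.FluctuationSpace)‖ ^ 2 + 1) < a := (lt_div_iff₀ hpos).mp hlt
  nlinarith [sq_nonneg ‖(φ : Z.toFluctuationDynamics.FluctuationSpace)‖]

end ChainAbel

/-! ## §4 The crux: an exact coboundary current at a regular witness kills (A⁻⁻), and with (R) the crux -/

open Literature.MathematicalPhysics.KineticTheory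
open Literature.MathematicalPhysics.KineticTheory.HeatConduction
open Summit.AtomisticToContinuum.FouriersLaw.Theorems
open Summit.AtomisticToContinuum.FouriersLaw.Theorems.AbelThermodynamicLimit.SeriesLawAtEveryLaplaceFrequency

/-- **`CurrentCoboundary` ⟹ ¬(A⁻⁻).**  Suppose that for all parameters `> 0` and `T > 0` some shift-invariant DLR state `μ_T` with a
`μ_T`-preserving infinite-volume dynamics with absolutely convergent summed current correlations carries zero-wavenumber data `Z`
(`Z.μ = μ_T`) whose Koopman group is strongly continuous, with zero mean current, in which the current class is an EXACT COBOUNDARY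
`[J] = Lφ`.  Then the registered bulk stub `stub_openChainAbelFloorFrequently` is FALSE: the landed matching S3 at (the `bmGood`-regularisation
of) that witness gives `F_N(ν)/N → Â(ν)`, and `Â(ν) < a` for all small `ν` by §3. [cite: EngelNagel2000, Ch. II Thm. 1.10] -/
theorem abelFloorFrequently_openChain_false_of_currentCoboundary :
    (∀ ω₂ lam β γ : ℝ, 0 < ω₂ → 0 < lam → 0 < β → 0 < γ → ∀ T : ℝ, 0 < T →
      ∃ (D : InfiniteChainDynamics (pinnedChain ω₂ lam β γ)) (Z : ZeroWavenumberData (pinnedChain ω₂ lam β γ) D),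
        (pinnedChain ω₂ lam β γ).IsChainGibbsMeasure T Z.μ ∧ IsShiftInvariant Z.μ ∧
        (∀ t : ℝ, D.HasAbsConvergentCorrelation Z.μ t) ∧
        Z.toFluctuationDynamics.IsStronglyContinuous ∧ (∫ σ, (pinnedChain ω₂ lam β γ).bondCurrentZ σ 0 ∂Z.μ = 0) ∧
        ∃ φ : Z.toFluctuationDynamics.generatorDomain, Z.toFluctuationDynamics.generator φ = Z.currentClass) →
    ¬ (∀ ω₂ lam β γ : ℝ, 0 < ω₂ → 0 < lam → 0 < β → 0 < γ → ∀ T : ℝ, 0 < T →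
      ∃ a : ℝ, 0 < a ∧ ∀ ν₁ : ℝ, 0 < ν₁ → ∃ ν : ℝ, 0 < ν ∧ ν < ν₁ ∧ ∃ N₀ : ℕ, ∀ N : ℕ, N₀ ≤ N →
        a * N ≤ ∫ t in Set.Ioi (0:ℝ), Real.exp (-(ν * t)) *
          ∫ z, (∑ i : Fin N, (pinnedChain ω₂ lam β γ).bondCurrent N i z) *
            (∫ y, (∑ i : Fin N, (pinnedChain ω₂ lam β γ).bondCurrent N i y)
              ∂((pinnedChain ω₂ lam β γ).transitionKernel N T T t.toNNReal z))
            ∂((pinnedChain ω₂ lam β γ).gibbsMeasure N T)) := by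
  intro hH hA
  -- work at the parameter point (1,1,1,1), T = 1
  obtain ⟨D', Z, hG, hS, hAC', hU, hmean, φ, hφ⟩ := hH 1 1 1 1 one_pos one_pos one_pos one_pos 1 one_pos
  obtain ⟨a, ha, hAν⟩ := hA 1 1 1 1 one_pos one_pos one_pos one_pos 1 one_pos
  set μT := Z.μ with hμT
  have hP' : D'.PreservesMeasure μT := Z.preservesMeasure
  haveI : IsProbabilityMeasure μT := hG.1
  have htight := Literature.MathematicalPhysics.KineticTheory.HeatConduction.oneSiteTight_of_isShiftInvariant (μ := μT) hS
  obtain ⟨_, hss⟩ :=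
    OscillatorChain.isShiftInvariant_and_hasSuperstabilityEstimate_of_tight_pinnedChain (1:ℝ) one_pos zero_le_one zero_le_one
      one_pos hG htight
  -- regularise the dynamics: restrict to the orbits staying in `bmGood` (same flow, same correlations)
  have horb : ∀ᵐ σ ∂μT, ∀ t : ℝ, D'.flow t σ ∈ (pinnedChain 1 1 1 1).bmGood :=
    OscillatorChain.ae_forall_flow_mem_bmGood_pinnedChain (1:ℝ) zero_le_one one_pos one_pos hss D' hP'
  obtain ⟨D, hcar, hflow⟩ :=
    GreenKuboContinuation.TemperatureBlindVitaliHurwitz.exists_restrictOrbits D' (pinnedChain 1 1 1 1).bmGood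
  have hcarsub : D.carrier ⊆ (pinnedChain 1 1 1 1).bmGood := by
    intro σ hσ
    rw [hcar] at hσ
    have h0 := hσ.2 0
    rwa [D'.flow_zero σ hσ.1] at h0
  have hP : D.PreservesMeasure μT := by
    refine GreenKuboContinuation.TemperatureBlindVitaliHurwitz.preservesMeasure_of_flow_eq hflow ?_ hP'
    rw [hcar]
    filter_upwards [hP'.1, horb] with σ h1 h2 using ⟨h1, h2⟩
  have hAC : ∀ t : ℝ, D.HasAbsConvergentCorrelation μT t := fun t => by
    rw [GreenKuboContinuation.TemperatureBlindVitaliHurwitz.hasAbsConvergentCorrelation_iff_of_flow_eq hflow]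
    exact hAC' t
  have hcorr : D.currentCorrelation μT = D'.currentCorrelation μT :=
    GreenKuboContinuation.TemperatureBlindVitaliHurwitz.currentCorrelation_eq_of_flow_eq hflow μT
  -- S3 at the regular pair
  have hS3 := fixedFrequencyMatching_of_registeredLeaves stub_uniformAnchoredCorrelationTails
    stub_uniformFixedTimeOffsetMatching 1 1 1 1 one_pos one_pos one_pos one_pos 1 one_pos
    (stub_regularDLRUnique 1 1 1 1 one_pos one_pos one_pos one_pos 1 one_pos) μT D hG hS hss hcarsub hP hAC
  -- no Abel floor at the coboundary witness
  obtain ⟨ν₁, hν₁, hsmall⟩ := ChainAbel.abelFunctional_lt_of_currentClass_eq_generator Z hU hmean φ hφ ha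
  obtain ⟨ν, hν, hνlt, N₀, hN₀⟩ := hAν ν₁ hν₁
  have hlim : a ≤ ∫ t in Ioi (0:ℝ), Real.exp (-(ν * t)) * D.currentCorrelation μT t := by
    refine ge_of_tendsto (hS3 ν hν) ?_
    filter_upwards [eventually_ge_atTop (max N₀ 1)] with N hN
    have hN0 : N₀ ≤ N := le_trans (le_max_left _ _) hN
    have hN1 : 1 ≤ N := le_trans (le_max_right _ _) hN
    have hNpos : (0:ℝ) < N := by exact_mod_cast hN1
    rw [le_div_iff₀ hNpos]
    exact hN₀ N hN0
  rw [hcorr] at hlim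
  have := hsmall ν hν hνlt
  linarith

/-- **`CurrentCoboundary` ∧ (R) ⟹ ¬`ConductanceLowerBound`.**  With the sibling `UniformAbelianRegularity` (stmt-13416) the crux implies
(A⁻⁻) (`abelFloorFrequently_openChain_of_conductanceLowerBound_of_uniformAbelianRegularity`, p161612), so an exact `ℋ₀`-primitive of the
current at a regular witness refutes the crux (and with it `FouriersLaw`, of which the crux is a necessary half).  This is the typed form of
the only insulating mechanism on record for a translation-invariant anharmonic bulk (asymptotic localisation makes `[J]` a coboundary to
all orders; an exact primitive is what a disprover must produce). [cite: EngelNagel2000, Ch. II Thm. 1.10] -/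
theorem conductanceLowerBound_false_of_currentCoboundary_of_uniformAbelianRegularity
    (hH : ∀ ω₂ lam β γ : ℝ, 0 < ω₂ → 0 < lam → 0 < β → 0 < γ → ∀ T : ℝ, 0 < T →
      ∃ (D : InfiniteChainDynamics (pinnedChain ω₂ lam β γ)) (Z : ZeroWavenumberData (pinnedChain ω₂ lam β γ) D),
        (pinnedChain ω₂ lam β γ).IsChainGibbsMeasure T Z.μ ∧ IsShiftInvariant Z.μ ∧
        (∀ t : ℝ, D.HasAbsConvergentCorrelation Z.μ t) ∧
        Z.toFluctuationDynamics.IsStronglyContinuous ∧ (∫ σ, (pinnedChain ω₂ lam β γ).bondCurrentZ σ 0 ∂Z.μ = 0) ∧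
        ∃ φ : Z.toFluctuationDynamics.generatorDomain, Z.toFluctuationDynamics.generator φ = Z.currentClass)
    (hR : Summit.AtomisticToContinuum.FouriersLaw.Theses.StaticAbelianSqueeze.UniformAbelianRegularity) :
    ¬ Summit.AtomisticToContinuum.FouriersLaw.Theses.JunctionLocality.ConductanceLowerBound := fun hC =>
  abelFloorFrequently_openChain_false_of_currentCoboundary hH
    (abelFloorFrequently_openChain_of_conductanceLowerBound_of_uniformAbelianRegularity hR hC)

/-- **`CurrentCoboundary` ⟹ ¬W⁻** (no shift-invariant bulk witness has an Abel floor frequently in `ν`): W⁻ ⟹ (A⁻⁻) is landed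
(`abelFloorFrequently_openChain_of_bulkWitnessFrequently`, p161612). [cite: EngelNagel2000, Ch. II Thm. 1.10] -/
theorem bulkWitnessFrequently_false_of_currentCoboundary
    (hH : ∀ ω₂ lam β γ : ℝ, 0 < ω₂ → 0 < lam → 0 < β → 0 < γ → ∀ T : ℝ, 0 < T →
      ∃ (D : InfiniteChainDynamics (pinnedChain ω₂ lam β γ)) (Z : ZeroWavenumberData (pinnedChain ω₂ lam β γ) D),
        (pinnedChain ω₂ lam β γ).IsChainGibbsMeasure T Z.μ ∧ IsShiftInvariant Z.μ ∧
        (∀ t : ℝ, D.HasAbsConvergentCorrelation Z.μ t) ∧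
        Z.toFluctuationDynamics.IsStronglyContinuous ∧ (∫ σ, (pinnedChain ω₂ lam β γ).bondCurrentZ σ 0 ∂Z.μ = 0) ∧
        ∃ φ : Z.toFluctuationDynamics.generatorDomain, Z.toFluctuationDynamics.generator φ = Z.currentClass) :
    ¬ (∀ ω₂ lam β γ : ℝ, 0 < ω₂ → 0 < lam → 0 < β → 0 < γ → ∀ T : ℝ, 0 < T →
      ∃ (μT : Measure ChainConfig) (D : InfiniteChainDynamics (pinnedChain ω₂ lam β γ)) (a : ℝ),
        (pinnedChain ω₂ lam β γ).IsChainGibbsMeasure T μT ∧ IsShiftInvariant μT ∧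
        D.PreservesMeasure μT ∧ (∀ t : ℝ, D.HasAbsConvergentCorrelation μT t) ∧ 0 < a ∧
        ∀ ν₁ : ℝ, 0 < ν₁ → ∃ ν : ℝ, 0 < ν ∧ ν < ν₁ ∧
          a ≤ ∫ t in Set.Ioi (0:ℝ), Real.exp (-(ν * t)) * D.currentCorrelation μT t) := fun hW =>
  abelFloorFrequently_openChain_false_of_currentCoboundary hH (abelFloorFrequently_openChain_of_bulkWitnessFrequently hW)

end Summit.AtomisticToContinuum.FouriersLaw.Cruxes.ConductanceLowerBound.AbelFloorExchange

end
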